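import Mathlib
import Literature.NumberTheory.Transcendental.KZCalculusProofs
import Literature.NumberTheory.Transcendental.SemialgebraicMapsProofs
import Literature.NumberTheory.Transcendental.KZSemialgebraicComplex
import Summits.KontsevichZagierPeriods.KontsevichZagierPeriods.Theorems.HyperbolicBlochOffTetraSectorKernelLadderFamilyExists

/-!
# Stub `stub_vPiece` — crux `OffTetraSectorKernel`, line `odd-hyperbolic-ladder` (rung 1)

Rung 1 of the hyperbolic scissors ladder: areas of `ℚ̄`-geodesic polygons of the hyperbolic PLANE,
upper half-plane model with coordinates `p : Fin 2 → ℝ`, `x = p 0`, height `t = p 1`, area density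
`1 / t ^ 2`. The line decomposes every polygon into V-PIECES
`V α β a c = {α < x < β, t > 0, (x − a)² + t² > c}` with `(α − a)² ≤ c`, `(β − a)² ≤ c`, `α < β`:
the region ABOVE the semicircle `(x − a)² + t² = c` inside the vertical strip `α < x < β`
(a geodesic triangle with one ideal vertex at `∞`).

We prove:
* (i) every V-piece with real-algebraic data `α, β, a, c` carries a Kontsevich–Zagier integral
  representation `[V, t⁻²]` (`KZ.IntegralRep 2` with integrand literally `fun p => 1 / p 1 ^ 2`):
  the domain is cut out by four strict polynomial inequalities with real-algebraic constants
  (`ℚ`-semialgebraic), the density is `1 / X₁²` with non-vanishing denominator, and the area is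
  finite: by Tonelli/Fubini over `ℝ × ℝ`, for `x ∈ (α, β)` one has `(x − a)² < c` (strict
  convexity), the fibre is the half-line `t > h(x) := √(c − (x − a)²)`, `∫_{h(x)}^∞ t⁻² dt = 1/h(x)`,
  and `∫_α^β dx / √(c − (x − a)²) = arcsin((β − a)/√c) − arcsin((α − a)/√c)` is the integral of
  the derivative of a monotone continuous function, hence finite;
* (ii) the standard doubly-ideal triangle `Std γ = V γ 1 0 1` (`−1 ≤ γ ≤ 1`) has area
  `∫_γ^1 dx / √(1 − x²) = arcsin 1 − arcsin γ = π/2 − arcsin γ = arccos γ`.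

References: M. Kontsevich, D. Zagier, *Periods* (2001), §1.1; J. Bochnak, M. Coste, M.-F. Roy,
*Real Algebraic Geometry* (1998), §2.2.
-/

noncomputable section

open Set MeasureTheory MvPolynomial
open Literature.NumberTheory.Transcendental Literature.ModelTheory.ExponentialFields

namespace Summit.KontsevichZagierPeriods.HyperbolicBloch.OffTetraSectorKernel

/-! ### One-dimensional facts -/

/-- Strict convexity of the square on an interval: for `α < x < β` with `(α − a)² ≤ c` and
`(β − a)² ≤ c` one has `(x − a)² < c`. [folklore] -/
theorem vPiece_sq_lt {α β a c x : ℝ} (hα : (α - a) ^ 2 ≤ c) (hβ : (β - a) ^ 2 ≤ c)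
    (h1 : α < x) (h2 : x < β) : (x - a) ^ 2 < c := by
  rcases le_or_gt 0 (x - a) with h | h
  · calc (x - a) ^ 2 < (β - a) ^ 2 := by nlinarith
      _ ≤ c := hβ
  · calc (x - a) ^ 2 < (α - a) ^ 2 := by nlinarith
      _ ≤ c := hα

/-- For a nondegenerate V-piece (`α < β`) the squared radius `c` is positive. [folklore] -/
theorem vPiece_c_pos {α β a c : ℝ} (hαβ : α < β) (hα : (α - a) ^ 2 ≤ c) (hβ : (β - a) ^ 2 ≤ c) :
    0 < c := by
  have h := vPiece_sq_lt hα hβ (show α < (α + β) / 2 by linarith) (show (α + β) / 2 < β by linarith)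
  nlinarith [sq_nonneg ((α + β) / 2 - a)]

/-- The vertical fibre of a V-piece over `x` is the half-line `t > √(c − (x − a)²)` (with Mathlib's
`√y = 0` for `y ≤ 0` this holds for every `x`). [folklore] -/
theorem vPiece_fibre_iff {x a c t : ℝ} :
    (0 < t ∧ c < (x - a) ^ 2 + t ^ 2) ↔ Real.sqrt (c - (x - a) ^ 2) < t := by
  constructor
  · rintro ⟨ht, h⟩
    exact (Real.sqrt_lt' ht).2 (by linarith)
  · intro h
    have ht : 0 < t := (Real.sqrt_nonneg _).trans_lt h
    have h' := (Real.sqrt_lt' ht).1 h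
    exact ⟨ht, by linarith⟩

/-- On a half-line `t > h > 0` the real power `t ^ (−2)` is `1 / t²`. [folklore] -/
theorem vPiece_rpow_eqOn {h : ℝ} (hh : 0 < h) :
    EqOn (fun t : ℝ => t ^ (-2 : ℝ)) (fun t : ℝ => 1 / t ^ 2) (Ioi h) := by
  intro t ht
  have ht0 : 0 < t := hh.trans ht
  simp only
  rw [Real.rpow_neg ht0.le, show (2 : ℝ) = ((2 : ℕ) : ℝ) by norm_num, Real.rpow_natCast, one_div]

/-- `∫_h^∞ t⁻² dt = 1/h` for `h > 0`. [folklore] -/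
theorem vPiece_integral_Ioi {h : ℝ} (hh : 0 < h) : ∫ t in Ioi h, 1 / t ^ 2 = 1 / h := by
  rw [← setIntegral_congr_fun measurableSet_Ioi (vPiece_rpow_eqOn hh),
    integral_Ioi_rpow_of_lt (by norm_num : (-2 : ℝ) < -1) hh,
    show (-2 : ℝ) + 1 = -1 by norm_num, Real.rpow_neg_one]
  rw [one_div, neg_div, ← div_neg, neg_neg, div_one]

/-- The primitive of `1 / √(c − (x − a)²)`: `d/dx arcsin((x − a)/√c) = 1 / √(c − (x − a)²)` where
`(x − a)² < c`. [folklore] -/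
theorem vPiece_hasDerivAt_arcsin {a c x : ℝ} (hc : 0 < c) (hx : (x - a) ^ 2 < c) :
    HasDerivAt (fun y => Real.arcsin ((y - a) / Real.sqrt c)) (1 / Real.sqrt (c - (x - a) ^ 2)) x := by
  have hsc : 0 < Real.sqrt c := Real.sqrt_pos.2 hc
  have hu : HasDerivAt (fun y : ℝ => (y - a) / Real.sqrt c) (1 / Real.sqrt c) x := by
    simpa using ((hasDerivAt_id x).sub_const a).div_const (Real.sqrt c)
  have hsq : ((x - a) / Real.sqrt c) ^ 2 = (x - a) ^ 2 / c := by
    rw [div_pow, Real.sq_sqrt hc.le]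
  have hlt : ((x - a) / Real.sqrt c) ^ 2 < 1 := by
    rw [hsq, div_lt_one hc]
    exact hx
  have habs : |(x - a) / Real.sqrt c| < 1 := by
    have h := Real.sqrt_lt_sqrt (sq_nonneg _) hlt
    rwa [Real.sqrt_sq_eq_abs, Real.sqrt_one] at h
  have h1 : (x - a) / Real.sqrt c ≠ -1 := fun h => by
    rw [h] at habs
    norm_num at habs
  have h2 : (x - a) / Real.sqrt c ≠ 1 := fun h => by
    rw [h] at habs
    norm_num at habs
  have hcomp := (Real.hasDerivAt_arcsin h1 h2).comp x hu
  refine hcomp.congr_deriv ?_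
  have hnn : 0 ≤ 1 - ((x - a) / Real.sqrt c) ^ 2 := by linarith
  rw [one_div_mul_one_div, ← Real.sqrt_mul hnn]
  congr 2
  rw [hsq]
  field_simp

/-- The primitive `x ↦ arcsin((x − a)/√c)` is continuous. [folklore] -/
theorem vPiece_continuous_arcsin (a c : ℝ) :
    Continuous fun y : ℝ => Real.arcsin ((y - a) / Real.sqrt c) :=
  Real.continuous_arcsin.comp (by fun_prop)

/-- `1 / √(c − (x − a)²)` is interval integrable on `[α, β]` when `(α − a)² ≤ c`, `(β − a)² ≤ c`,
`c > 0`: it is the nonnegative derivative on `(α, β)` of the continuous function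
`arcsin((x − a)/√c)`. [folklore] -/
theorem vPiece_intervalIntegrable {α β a c : ℝ} (hαβ : α ≤ β) (hα : (α - a) ^ 2 ≤ c)
    (hβ : (β - a) ^ 2 ≤ c) (hc : 0 < c) :
    IntervalIntegrable (fun x => 1 / Real.sqrt (c - (x - a) ^ 2)) volume α β := by
  refine intervalIntegral.intervalIntegrable_deriv_of_nonneg
    (g := fun y => Real.arcsin ((y - a) / Real.sqrt c)) (vPiece_continuous_arcsin a c).continuousOn
    (fun x hx => ?_) (fun x _ => by positivity)
  rw [min_eq_left hαβ, max_eq_right hαβ] at hx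
  exact vPiece_hasDerivAt_arcsin hc (vPiece_sq_lt hα hβ hx.1 hx.2)

/-- `1 / √(c − (x − a)²)` is integrable on `(α, β)` (same hypotheses). [folklore] -/
theorem vPiece_integrableOn_Ioo {α β a c : ℝ} (hαβ : α ≤ β) (hα : (α - a) ^ 2 ≤ c)
    (hβ : (β - a) ^ 2 ≤ c) (hc : 0 < c) :
    IntegrableOn (fun x => 1 / Real.sqrt (c - (x - a) ^ 2)) (Ioo α β) :=
  (intervalIntegrable_iff_integrableOn_Ioo_of_le hαβ).1 (vPiece_intervalIntegrable hαβ hα hβ hc)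

/-- **The area integral in `x`**: `∫_α^β dx / √(c − (x − a)²) = arcsin((β − a)/√c) − arcsin((α − a)/√c)`
(fundamental theorem of calculus). [folklore] -/
theorem vPiece_integral_Ioo {α β a c : ℝ} (hαβ : α ≤ β) (hα : (α - a) ^ 2 ≤ c)
    (hβ : (β - a) ^ 2 ≤ c) (hc : 0 < c) :
    ∫ x in Ioo α β, 1 / Real.sqrt (c - (x - a) ^ 2) =
      Real.arcsin ((β - a) / Real.sqrt c) - Real.arcsin ((α - a) / Real.sqrt c) := by
  rw [← integral_Ioc_eq_integral_Ioo, ← intervalIntegral.integral_of_le hαβ]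
  exact intervalIntegral.integral_eq_sub_of_hasDerivAt_of_le hαβ
    (vPiece_continuous_arcsin a c).continuousOn
    (fun x hx => vPiece_hasDerivAt_arcsin hc (vPiece_sq_lt hα hβ hx.1 hx.2))
    (vPiece_intervalIntegrable hαβ hα hβ hc)

/-! ### The V-piece in the plane `ℝ × ℝ`: Tonelli–Fubini -/

/-- The V-piece read in `ℝ × ℝ` is Lebesgue measurable (it is open). [folklore] -/
theorem vPiece_measurableSet_plane (α β a c : ℝ) :
    MeasurableSet {q : ℝ × ℝ | α < q.1 ∧ q.1 < β ∧ 0 < q.2 ∧ c < (q.1 - a) ^ 2 + q.2 ^ 2} := by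
  have e : {q : ℝ × ℝ | α < q.1 ∧ q.1 < β ∧ 0 < q.2 ∧ c < (q.1 - a) ^ 2 + q.2 ^ 2} =
      {q : ℝ × ℝ | α < q.1} ∩ ({q | q.1 < β} ∩ ({q | 0 < q.2} ∩
        {q | c < (q.1 - a) ^ 2 + q.2 ^ 2})) := by
    ext q
    simp
  rw [e]
  refine (measurableSet_lt ?_ ?_).inter ((measurableSet_lt ?_ ?_).inter
    ((measurableSet_lt ?_ ?_).inter (measurableSet_lt ?_ ?_))) <;> fun_prop

/-- **The fibres of `𝟙_V · t⁻²`.** Over `x ∈ (α, β)` the fibre function is `𝟙_{t > h(x)} t⁻²`,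
`h(x) = √(c − (x − a)²)`; over `x ∉ (α, β)` it vanishes. [folklore] -/
theorem vPiece_indicator_fibre (α β a c x t : ℝ) :
    ({q : ℝ × ℝ | α < q.1 ∧ q.1 < β ∧ 0 < q.2 ∧ c < (q.1 - a) ^ 2 + q.2 ^ 2}).indicator
        (fun q : ℝ × ℝ => 1 / q.2 ^ 2) (x, t) =
      (Ioo α β).indicator
        (fun x => (Ioi (Real.sqrt (c - (x - a) ^ 2))).indicator (fun t : ℝ => 1 / t ^ 2) t) x := by
  by_cases hx : x ∈ Ioo α β
  · rw [indicator_of_mem hx]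
    by_cases ht : Real.sqrt (c - (x - a) ^ 2) < t
    · rw [indicator_of_mem (show t ∈ Ioi _ from ht), indicator_of_mem]
      exact ⟨hx.1, hx.2, vPiece_fibre_iff.2 ht⟩
    · rw [indicator_of_notMem (show t ∉ Ioi _ from ht), indicator_of_notMem]
      rintro ⟨-, -, h3, h4⟩
      exact ht (vPiece_fibre_iff.1 ⟨h3, h4⟩)
  · rw [indicator_of_notMem hx, indicator_of_notMem]
    rintro ⟨h1, h2, -⟩
    exact hx ⟨h1, h2⟩

/-- **The fibre integrals**: `∫ 𝟙_V(x, t) t⁻² dt = 𝟙_{(α, β)}(x) / √(c − (x − a)²)`. [folklore] -/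
theorem vPiece_integral_fibre {α β a c : ℝ} (hα : (α - a) ^ 2 ≤ c) (hβ : (β - a) ^ 2 ≤ c)
    (x : ℝ) :
    ∫ t : ℝ, ({q : ℝ × ℝ | α < q.1 ∧ q.1 < β ∧ 0 < q.2 ∧ c < (q.1 - a) ^ 2 + q.2 ^ 2}).indicator
        (fun q : ℝ × ℝ => 1 / q.2 ^ 2) (x, t) =
      (Ioo α β).indicator (fun x => 1 / Real.sqrt (c - (x - a) ^ 2)) x := by
  simp_rw [vPiece_indicator_fibre]
  by_cases hx : x ∈ Ioo α β
  · have hxc : (x - a) ^ 2 < c := vPiece_sq_lt hα hβ hx.1 hx.2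
    have hh : 0 < Real.sqrt (c - (x - a) ^ 2) := Real.sqrt_pos.2 (by linarith)
    simp_rw [indicator_of_mem hx]
    rw [integral_indicator measurableSet_Ioi, vPiece_integral_Ioi hh]
  · simp_rw [indicator_of_notMem hx]
    exact integral_zero _ _

/-- The function `𝟙_V · t⁻²` is nonnegative. [folklore] -/
theorem vPiece_indicator_nonneg (α β a c : ℝ) (q : ℝ × ℝ) :
    0 ≤ ({q : ℝ × ℝ | α < q.1 ∧ q.1 < β ∧ 0 < q.2 ∧ c < (q.1 - a) ^ 2 + q.2 ^ 2}).indicator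
        (fun q : ℝ × ℝ => 1 / q.2 ^ 2) q :=
  indicator_nonneg (fun q _ => by positivity) q

/-- **Finite area (Tonelli).** `𝟙_V · t⁻²` is integrable on `ℝ × ℝ`: every fibre `𝟙_{t > h(x)} t⁻²`
is integrable and the fibre integrals `𝟙_{(α,β)}(x)/√(c − (x − a)²)` form an integrable function.
[cite: KontsevichZagier2001, §1.1] -/
theorem vPiece_integrable_prod {α β a c : ℝ} (hαβ : α ≤ β) (hα : (α - a) ^ 2 ≤ c)
    (hβ : (β - a) ^ 2 ≤ c) (hc : 0 < c) :
    Integrable (({q : ℝ × ℝ | α < q.1 ∧ q.1 < β ∧ 0 < q.2 ∧ c < (q.1 - a) ^ 2 + q.2 ^ 2}).indicator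
        (fun q : ℝ × ℝ => 1 / q.2 ^ 2)) ((volume : Measure ℝ).prod (volume : Measure ℝ)) := by
  have hSm := vPiece_measurableSet_plane α β a c
  have hgm : Measurable fun q : ℝ × ℝ => 1 / q.2 ^ 2 := by fun_prop
  rw [integrable_prod_iff ((hgm.indicator hSm).aestronglyMeasurable)]
  refine ⟨ae_of_all _ fun x => ?_, ?_⟩
  · simp_rw [vPiece_indicator_fibre]
    by_cases hx : x ∈ Ioo α β
    · have hxc : (x - a) ^ 2 < c := vPiece_sq_lt hα hβ hx.1 hx.2
      have hh : 0 < Real.sqrt (c - (x - a) ^ 2) := Real.sqrt_pos.2 (by linarith)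
      simp_rw [indicator_of_mem hx]
      -- the fibre `t⁻² = t ^ (-2)` is integrable on the half-line `t > h(x) > 0`
      exact (integrable_indicator_iff measurableSet_Ioi).2
        ((integrableOn_Ioi_rpow_of_lt (by norm_num : (-2 : ℝ) < -1) hh).congr_fun
          (vPiece_rpow_eqOn hh) measurableSet_Ioi)
    · simp_rw [indicator_of_notMem hx]
      exact integrable_zero _ _ _
  · have e : (fun x : ℝ => ∫ t : ℝ, ‖({q : ℝ × ℝ | α < q.1 ∧ q.1 < β ∧ 0 < q.2 ∧
          c < (q.1 - a) ^ 2 + q.2 ^ 2}).indicator (fun q : ℝ × ℝ => 1 / q.2 ^ 2) (x, t)‖) =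
        (Ioo α β).indicator (fun x => 1 / Real.sqrt (c - (x - a) ^ 2)) := by
      ext x
      rw [← vPiece_integral_fibre hα hβ x]
      exact integral_congr_ae (ae_of_all _ fun t => Real.norm_of_nonneg
        (vPiece_indicator_nonneg α β a c (x, t)))
    rw [e, integrable_indicator_iff measurableSet_Ioo]
    exact vPiece_integrableOn_Ioo hαβ hα hβ hc

/-- **The area (Fubini).** `∫∫ 𝟙_V t⁻² dt dx = arcsin((β − a)/√c) − arcsin((α − a)/√c)`.
[cite: KontsevichZagier2001, §1.1] -/
theorem vPiece_integral_prod {α β a c : ℝ} (hαβ : α ≤ β) (hα : (α - a) ^ 2 ≤ c)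
    (hβ : (β - a) ^ 2 ≤ c) (hc : 0 < c) :
    ∫ q, ({q : ℝ × ℝ | α < q.1 ∧ q.1 < β ∧ 0 < q.2 ∧ c < (q.1 - a) ^ 2 + q.2 ^ 2}).indicator
        (fun q : ℝ × ℝ => 1 / q.2 ^ 2) q ∂((volume : Measure ℝ).prod (volume : Measure ℝ)) =
      Real.arcsin ((β - a) / Real.sqrt c) - Real.arcsin ((α - a) / Real.sqrt c) := by
  rw [integral_prod _ (vPiece_integrable_prod hαβ hα hβ hc)]
  have e : (fun x : ℝ => ∫ t : ℝ, ({q : ℝ × ℝ | α < q.1 ∧ q.1 < β ∧ 0 < q.2 ∧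
        c < (q.1 - a) ^ 2 + q.2 ^ 2}).indicator (fun q : ℝ × ℝ => 1 / q.2 ^ 2) (x, t)) =
      (Ioo α β).indicator (fun x => 1 / Real.sqrt (c - (x - a) ^ 2)) :=
    funext fun x => vPiece_integral_fibre hα hβ x
  rw [e, integral_indicator measurableSet_Ioo, vPiece_integral_Ioo hαβ hα hβ hc]

/-! ### Transport to `Fin 2 → ℝ` -/

/-- The V-piece of `Fin 2 → ℝ` is the preimage of the plane V-piece under `p ↦ (p 0, p 1)`.
[folklore] -/
theorem vPiece_eq_preimage (α β a c : ℝ) :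
    {p : Fin 2 → ℝ | α < p 0 ∧ p 0 < β ∧ 0 < p 1 ∧ c < (p 0 - a) ^ 2 + p 1 ^ 2} =
      MeasurableEquiv.finTwoArrow ⁻¹'
        {q : ℝ × ℝ | α < q.1 ∧ q.1 < β ∧ 0 < q.2 ∧ c < (q.1 - a) ^ 2 + q.2 ^ 2} := by
  ext p
  simp [MeasurableEquiv.finTwoArrow_apply]

/-- **Finite area of a V-piece**: `t⁻²` is integrable on `V α β a c` (`α ≤ β`, `(α − a)² ≤ c`,
`(β − a)² ≤ c`, `c > 0`). [cite: KontsevichZagier2001, §1.1] -/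
theorem vPiece_integrableOn {α β a c : ℝ} (hαβ : α ≤ β) (hα : (α - a) ^ 2 ≤ c)
    (hβ : (β - a) ^ 2 ≤ c) (hc : 0 < c) :
    IntegrableOn (fun p : Fin 2 → ℝ => 1 / p 1 ^ 2)
      {p : Fin 2 → ℝ | α < p 0 ∧ p 0 < β ∧ 0 < p 1 ∧ c < (p 0 - a) ^ 2 + p 1 ^ 2} := by
  rw [vPiece_eq_preimage]
  refine ((volume_preserving_finTwoArrow ℝ).integrableOn_comp_preimage
    (MeasurableEquiv.measurableEmbedding _) (f := fun q : ℝ × ℝ => 1 / q.2 ^ 2)).2 ?_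
  rw [← integrable_indicator_iff (vPiece_measurableSet_plane α β a c), Measure.volume_eq_prod]
  exact vPiece_integrable_prod hαβ hα hβ hc

/-- **Area of a V-piece**: `∫_V t⁻² = arcsin((β − a)/√c) − arcsin((α − a)/√c)`.
[cite: KontsevichZagier2001, §1.1] -/
theorem vPiece_setIntegral {α β a c : ℝ} (hαβ : α ≤ β) (hα : (α - a) ^ 2 ≤ c)
    (hβ : (β - a) ^ 2 ≤ c) (hc : 0 < c) :
    ∫ p in {p : Fin 2 → ℝ | α < p 0 ∧ p 0 < β ∧ 0 < p 1 ∧ c < (p 0 - a) ^ 2 + p 1 ^ 2},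
        1 / p 1 ^ 2 =
      Real.arcsin ((β - a) / Real.sqrt c) - Real.arcsin ((α - a) / Real.sqrt c) := by
  rw [vPiece_eq_preimage]
  have h := (volume_preserving_finTwoArrow ℝ).setIntegral_preimage_emb
    (MeasurableEquiv.measurableEmbedding _) (fun q : ℝ × ℝ => 1 / q.2 ^ 2)
    {q : ℝ × ℝ | α < q.1 ∧ q.1 < β ∧ 0 < q.2 ∧ c < (q.1 - a) ^ 2 + q.2 ^ 2}
  rw [show (fun x : Fin 2 → ℝ => (fun q : ℝ × ℝ => 1 / q.2 ^ 2) (MeasurableEquiv.finTwoArrow x)) =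
      fun p : Fin 2 → ℝ => 1 / p 1 ^ 2 from funext fun p => by
        simp [MeasurableEquiv.finTwoArrow_apply]] at h
  rw [h, ← integral_indicator (vPiece_measurableSet_plane α β a c), Measure.volume_eq_prod]
  exact vPiece_integral_prod hαβ hα hβ hc

/-! ### Semialgebraic data -/

/-- **The V-piece is `ℚ`-semialgebraic** for real-algebraic `α, β, a, c`: four strict inequalities
between `ℚ`-semialgebraic functions (coordinates, real-algebraic constants, sums and products;
Tarski–Seidenberg). [cite: KontsevichZagier2001, §1.1] -/
theorem vPiece_isSemialgebraic {α β a c : ℝ} (hα : IsAlgebraic ℚ α) (hβ : IsAlgebraic ℚ β)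
    (ha : IsAlgebraic ℚ a) (hc : IsAlgebraic ℚ c) :
    IsSemialgebraic ℚ
      {p : Fin 2 → ℝ | α < p 0 ∧ p 0 < β ∧ 0 < p 1 ∧ c < (p 0 - a) ^ 2 + p 1 ^ 2} := by
  have hU : IsSemialgebraic ℚ (univ : Set (Fin 2 → ℝ)) := isSemialgebraic_univ
  have hco : ∀ i : Fin 2, IsSemialgebraicFunOn ℚ (univ : Set (Fin 2 → ℝ)) (fun p => p i) :=
    fun i => isSemialgebraicFunOn_apply_univ i
  have hk : ∀ {r : ℝ}, IsAlgebraic ℚ r →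
      IsSemialgebraicFunOn ℚ (univ : Set (Fin 2 → ℝ)) (fun _ => r) :=
    fun hr => isSemialgebraicFunOn_const_of_isAlgebraic hU hr
  have S1 : IsSemialgebraic ℚ {p : Fin 2 → ℝ | α < p 0} :=
    isSemialgebraic_setOf_lt_of_isSemialgebraicFunOn (hk hα) (hco 0)
  have S2 : IsSemialgebraic ℚ {p : Fin 2 → ℝ | p 0 < β} :=
    isSemialgebraic_setOf_lt_of_isSemialgebraicFunOn (hco 0) (hk hβ)
  have S3 : IsSemialgebraic ℚ {p : Fin 2 → ℝ | 0 < p 1} :=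
    isSemialgebraic_setOf_lt_of_isSemialgebraicFunOn (hk isAlgebraic_zero) (hco 1)
  have h1 : IsSemialgebraicFunOn ℚ (univ : Set (Fin 2 → ℝ)) (fun p => p 0 - a) :=
    IsSemialgebraicFunOn.sub_holds (hco 0) (hk ha)
  have hq : IsSemialgebraicFunOn ℚ (univ : Set (Fin 2 → ℝ)) (fun p => (p 0 - a) ^ 2 + p 1 ^ 2) :=
    (IsSemialgebraicFunOn.add_holds (IsSemialgebraicFunOn.mul_holds h1 h1)
      (IsSemialgebraicFunOn.mul_holds (hco 1) (hco 1))).congr fun p _ => by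
        simp only [Pi.add_apply, Pi.mul_apply, sq]
  have S4 : IsSemialgebraic ℚ {p : Fin 2 → ℝ | c < (p 0 - a) ^ 2 + p 1 ^ 2} :=
    isSemialgebraic_setOf_lt_of_isSemialgebraicFunOn (hk hc) hq
  have e : {p : Fin 2 → ℝ | α < p 0 ∧ p 0 < β ∧ 0 < p 1 ∧ c < (p 0 - a) ^ 2 + p 1 ^ 2} =
      {p : Fin 2 → ℝ | α < p 0} ∩ ({p | p 0 < β} ∩ ({p | 0 < p 1} ∩
        {p | c < (p 0 - a) ^ 2 + p 1 ^ 2})) := by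
    ext p
    simp
  rw [e]
  exact S1.inter (S2.inter (S3.inter S4))

/-- The area density `t⁻² = 1 / X₁²` is a `ℚ`-semialgebraic function on every `ℚ`-semialgebraic
subset of the open upper half-plane (quotient of rational polynomials with non-vanishing
denominator). [cite: KontsevichZagier2001, §1.1] -/
theorem vPiece_isSemialgebraicFunOn_density {s : Set (Fin 2 → ℝ)} (hs : IsSemialgebraic ℚ s)
    (h : ∀ p ∈ s, 0 < p 1) : IsSemialgebraicFunOn ℚ s (fun p : Fin 2 → ℝ => 1 / p 1 ^ 2) := by
  have hq : ∀ p ∈ s, aeval p (X 1 ^ 2 : MvPolynomial (Fin 2) ℚ) ≠ 0 := fun p hp => by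
    simpa using pow_ne_zero 2 (h p hp).ne'
  exact (isSemialgebraicFunOn_aeval_div_aeval hs 1 (X 1 ^ 2) hq).congr fun p _ => by simp

/-- **The Kontsevich–Zagier representation `[V α β a c, t⁻²]`** of the area of a V-piece with
real-algebraic data (`α < β`, `(α − a)² ≤ c`, `(β − a)² ≤ c`): the domain is `ℚ`-semialgebraic, the
density `t⁻²` is `ℚ`-semialgebraic on it (`V ⊆ {t > 0}`) and integrable (finite area).
[cite: KontsevichZagier2001, §1.1] -/
theorem vPiece_exists_rep {α β a c : ℝ} (hα : IsAlgebraic ℚ α) (hβ : IsAlgebraic ℚ β)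
    (ha : IsAlgebraic ℚ a) (hc : IsAlgebraic ℚ c) (hαβ : α < β) (h1 : (α - a) ^ 2 ≤ c)
    (h2 : (β - a) ^ 2 ≤ c) :
    ∃ r : KZ.IntegralRep 2,
      r.domain = {p : Fin 2 → ℝ | α < p 0 ∧ p 0 < β ∧ 0 < p 1 ∧ c < (p 0 - a) ^ 2 + p 1 ^ 2} ∧
      r.integrand = fun p => 1 / p 1 ^ 2 :=
  ⟨{ domain := {p : Fin 2 → ℝ | α < p 0 ∧ p 0 < β ∧ 0 < p 1 ∧ c < (p 0 - a) ^ 2 + p 1 ^ 2}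
     integrand := fun p => 1 / p 1 ^ 2
     isSemialgebraic_domain := vPiece_isSemialgebraic hα hβ ha hc
     isSemialgebraicFunOn_integrand :=
       vPiece_isSemialgebraicFunOn_density (vPiece_isSemialgebraic hα hβ ha hc) fun _ hp => hp.2.2.1
     integrableOn := vPiece_integrableOn hαβ.le h1 h2 (vPiece_c_pos hαβ h1 h2) }, rfl, rfl⟩

/-- **Area of the standard doubly-ideal triangle**: for `−1 ≤ γ ≤ 1`,
`∫_{Std γ} t⁻² = arcsin 1 − arcsin γ = arccos γ`, `Std γ = V γ 1 0 1`. [cite: KontsevichZagier2001, §1.1] -/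
theorem vPiece_setIntegral_std {γ : ℝ} (h1 : -1 ≤ γ) (h2 : γ ≤ 1) :
    ∫ p in {p : Fin 2 → ℝ | γ < p 0 ∧ p 0 < 1 ∧ 0 < p 1 ∧ 1 < (p 0 - 0) ^ 2 + p 1 ^ 2},
        1 / p 1 ^ 2 = Real.arccos γ := by
  have hγ : (γ - 0) ^ 2 ≤ 1 := by nlinarith
  rw [vPiece_setIntegral h2 hγ (by norm_num) one_pos, Real.arccos_eq_pi_div_two_sub_arcsin]
  simp [Real.arcsin_one]

/-- **STUB `stub_vPiece`**: (i) every V-piece with algebraic data carries a Kontsevich–Zagier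
representation `[V, t⁻²]` (`ℚ`-semialgebraic domain, finite area `∫ dx/√(c−(x−a)²) < ∞`); (ii) the
standard doubly-ideal triangle `Std γ = V γ 1 0 1` has area `∫_γ^1 dx/√(1−x²) = arccos γ`.
[cite: KontsevichZagier2001, §1.1] -/
theorem stub_vPiece :
    ∀ (V : ℝ → ℝ → ℝ → ℝ → Set (Fin 2 → ℝ)),
      (∀ α β a c, V α β a c = {p | α < p 0 ∧ p 0 < β ∧ 0 < p 1 ∧ c < (p 0 - a) ^ 2 + p 1 ^ 2}) →
    (∀ α β a c : ℝ, IsAlgebraic ℚ α → IsAlgebraic ℚ β → IsAlgebraic ℚ a → IsAlgebraic ℚ c →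
        α < β → (α - a) ^ 2 ≤ c → (β - a) ^ 2 ≤ c →
        ∃ r : KZ.IntegralRep 2, r.domain = V α β a c ∧ r.integrand = fun p => 1 / p 1 ^ 2) ∧
    (∀ γ : ℝ, -1 ≤ γ → γ ≤ 1 → ∀ r : KZ.IntegralRep 2, r.domain = V γ 1 0 1 →
        EqOn r.integrand (fun p => 1 / p 1 ^ 2) r.domain → r.value = Real.arccos γ) := by
  intro V hV
  refine ⟨fun α β a c hα hβ ha hc hαβ h1 h2 => ?_, fun γ hγ1 hγ2 r hr hri => ?_⟩
  · rw [hV]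
    exact vPiece_exists_rep hα hβ ha hc hαβ h1 h2
  · unfold KZ.IntegralRep.value
    rw [setIntegral_congr_fun (KZ.IntegralRep.measurableSet_domain_holds r) hri, hr, hV]
    exact vPiece_setIntegral_std hγ1 hγ2

end Summit.KontsevichZagierPeriods.HyperbolicBloch.OffTetraSectorKernel

end
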